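import Mathlib.MeasureTheory.Measure.Decomposition.RadonNikodym
import Literature.Probability.Percolation.FlipFairKernel

/-!
# Density triviality implies midpoint-extremality (stub 4 of the birth skeleton of `FlipErgodicityZ2`)

Route `Summits/CriticalPhenomena/CardyFormulaZ2/Theses/CardyMeckeFlip`, crux `FlipErgodicityZ2`
(item stmt-CriticalPhenomena-14825), line `registered`.  Pure measure theory, no percolation:
if every bounded density `f ≤ 2` whose tilt `f·P` is a flip-fair probability law is trivial
(`f·P = P`), then `P` is flip-extremal (`IsFlipExtremal P M`, clause (EXT)).

Proof: from `P₁ + P₂ = P + P` with `P₁, P₂` probability laws, `P` is a probability law and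
`P₁ ≤ P + P = P.withDensity 2`, so `P₁ ≪ P` and `∂P₁/∂P ≤ 2` `P`-a.e.; hence
`P₁ = P.withDensity f` with `f = min (∂P₁/∂P) 2` measurable and `≤ 2`
(`Measure.absolutelyContinuous_of_le`, `Measure.withDensity_rnDeriv_eq`), and triviality gives
`P₁ = P`.
-/

noncomputable section

open MeasureTheory Set
open Literature.Probability.Percolation Literature.Probability.Percolation.QuadCrossing

namespace Summit.CriticalPhenomena.CardyFormulaZ2.Theorems.CardyMeckeFlip

/-- A measure dominated by `f dν` has Radon–Nikodym derivative `≤ f` `ν`-almost everywhere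
(`ν` σ-finite). [folklore] -/
private theorem rnDeriv_ae_le_of_le_withDensity {α : Type*} [MeasurableSpace α]
    {μ ν : Measure α} [SigmaFinite ν] {f : α → ENNReal} (h : μ ≤ ν.withDensity f) :
    μ.rnDeriv ν ≤ᵐ[ν] f := by
  refine ae_le_of_forall_setLIntegral_le_of_sigmaFinite (μ.measurable_rnDeriv ν) fun s hs _ => ?_
  calc ∫⁻ x in s, μ.rnDeriv ν x ∂ν ≤ μ s := Measure.setLIntegral_rnDeriv_le s
    _ ≤ ν.withDensity f s := Measure.le_iff'.1 h s
    _ = ∫⁻ x in s, f x ∂ν := withDensity_apply f hs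

/-- If two extended non-negative reals with sum `1 + 1 = a + a` then `a = 1`. [folklore] -/
private theorem eq_one_of_add_self_eq_two {a : ENNReal} (h : (1 : ENNReal) + 1 = a + a) :
    a = 1 := by
  rw [← two_mul, ← two_mul] at h
  exact ((ENNReal.mul_right_inj two_ne_zero ENNReal.ofNat_ne_top).1 h).symm

/-- **Density triviality ⇒ midpoint-extremality** (stub 4 of the birth skeleton of crux
`FlipErgodicityZ2`): if every bounded density `f ≤ 2` with `f·P` a flip-fair probability law is
trivial (`P.withDensity f = P`), then `P` is flip-extremal for `M` — `P₁ + P₂ = P + P` forces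
`P₁ ≤ 2P`, hence `P₁ = P.withDensity f` with `f = min (∂P₁/∂P) 2`. [folklore] -/
theorem stub_flipExtremal_of_trivialDensity :
    ∀ (P : Measure (QuadConfig (Set.univ : Set ℂ)))
      (M : ℝ → QuadConfig (Set.univ : Set ℂ) → Measure ℂ),
      (∀ f : QuadConfig (Set.univ : Set ℂ) → ENNReal, Measurable f → (∀ S, f S ≤ 2) →
        IsProbabilityMeasure (P.withDensity f) →
          (∀ ε : ℝ, 0 < ε → IsFlipFairKernel (P.withDensity f) (M ε)) →
            P.withDensity f = P) →
        IsFlipExtremal P M := by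
  intro P M htriv P₁ P₂ hP₁ _hP₂ h₁ _h₂ hsum
  -- (a) `P` is a probability measure: evaluate the midpoint identity on `univ`.
  have hPuniv : P univ = 1 := by
    have h := congrArg (fun ν : Measure (QuadConfig (Set.univ : Set ℂ)) => ν univ) hsum
    simp only [Measure.add_apply, measure_univ] at h
    exact eq_one_of_add_self_eq_two h
  haveI : IsProbabilityMeasure P := ⟨hPuniv⟩
  -- (b) `P₁ ≤ P + P = P.withDensity 2`, hence `P₁ ≪ P`.
  have hle : P₁ ≤ P.withDensity (fun _ => 2) := by
    rw [withDensity_const]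
    calc P₁ ≤ P₁ + P₂ := Measure.le_add_right le_rfl
      _ = P + P := hsum
      _ = (2 : ENNReal) • P := (two_smul ENNReal P).symm
  have hac : P₁ ≪ P :=
    (Measure.absolutelyContinuous_of_le hle).trans (withDensity_absolutelyContinuous P _)
  -- (c) the Radon–Nikodym derivative is a.e. bounded by `2` and represents `P₁`.
  have hg_le : P₁.rnDeriv P ≤ᵐ[P] fun _ => 2 := rnDeriv_ae_le_of_le_withDensity hle
  -- (d) the truncated density `f = min (∂P₁/∂P) 2`.
  set f : QuadConfig (Set.univ : Set ℂ) → ENNReal := fun S => min (P₁.rnDeriv P S) 2 with hf_def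
  have hf_meas : Measurable f := (Measure.measurable_rnDeriv P₁ P).min measurable_const
  have hf_le : ∀ S, f S ≤ 2 := fun S => min_le_right _ _
  have hf_ae : f =ᵐ[P] P₁.rnDeriv P := hg_le.mono fun S hS => min_eq_left hS
  have hPf : P.withDensity f = P₁ := by
    rw [withDensity_congr_ae hf_ae]
    exact Measure.withDensity_rnDeriv_eq P₁ P hac
  -- (e) triviality of bounded flip-fair densities.
  have htrivf : P.withDensity f = P :=
    htriv f hf_meas hf_le (hPf ▸ hP₁) (fun ε hε => hPf ▸ h₁ ε hε)
  rwa [hPf] at htrivf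

end Summit.CriticalPhenomena.CardyFormulaZ2.Theorems.CardyMeckeFlip

end
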